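import Summits.QuantumAdvantage.QuantumAdvantage.Theorems.SosSandwichTransferPBKeyedLanguageP
import Summits.QuantumAdvantage.QuantumAdvantage.Theorems.SosSandwichTransferPBLayoutFP
import Literature.Computability.QuantumComplexity.OracleRemovalKernel
import Literature.Computability.QuantumComplexity.PolyBlockStatReadout
import Literature.Computability.Cryptography.ClassBQPProofs
import HarnessLib

/-!
# Crux `TransferPB` (stmt-QuantumAdvantage-15238, route SosSandwich), line `birth` — the MEAN node tests are in `PromiseBQP`

Obligation (Q) of the last stub `stub_pbOracleSimulation` asks `nodeProblem F r c k ∈ PromiseBQP`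
(`Theorems/SosSandwichTransferPBMachineDefs.lean`); the node problem has three kinds of instances (BLOCK, SINGLE, MEAN).
This file carries the MEAN kind END TO END through the pipeline the previous hands built, as the warm-up (3) of the
repair census of hand g5 — every interface of the final assembly except the truncated-runs family is exercised:

* **`meanProblem F`** — the MEAN slice of the node problem (`⟨x, ρ, j⟩`: YES if `E[p_x|_ρ] ≥ j/40`, NO if `≤ (j−1)/40`,
  `1 ≤ j ≤ 40`); `meanRun F` — the keyed run with `nOf = nOfLayout` (`Theorems/…LayoutFP.lean`);
* `readRun_take` — the transported read-out ignores appended ancilla wires (oracle removal appends wires);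
  **`meanStat F z s`** — the answer bit of the keyed run read off the output string `s` on the layout `z`
  (`[0 < n + anc n] ∧ s[if 0 < n then 0 else |z|]`), `meanStat_eq` (it is `[1 ⊑ readRun]`), `meanStatC` (on codes for
  uniform `F`: `codeFP_nOfLayout`, `codeFP_rawDesc`);
* **`meanNum z = 2j − 1`** read off the layout (`drop nOfLayout |z|`, `fstF`, `sndF`, `sndF`, length), `meanNumC`,
  `meanNum_layoutFn_encMean`;
* **`meanProblem_mem_PromiseBQP`** — for uniform `F`, `meanProblem F ∈ PromiseBQP`: layout `layoutFn ∈ FP`; the keyed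
  estimator family is uniform (`keyedRun_family_isUniform`) and its answer event has probability EXACTLY `nodeMean`
  (`kernelProb_keyedRun_layoutFn_encMean`); its oracle `keyedLang F ∈ P ⊆ BQP` (`keyedLang_mem_P`, `P_subset_BQP_holds`)
  is removed with every output event controlled to `1/160` (`exists_oracleFree_kernelProb_close`); the one-bit block
  statistic `meanStat` with threshold `(2j−1)/80` and margin `1/160` is read out by
  `PolyCopies.mem_PromiseBQP_of_blockStat_thresholds_pre`.

All proved; definitions are explicit (a promise problem, a `KeyedRun`, two string functions). No named fact.
Sources: S. Aaronson, A. Ambainis, Theory Comput. 10 (2014), proof of Thm. 23 (p. 14); C. H. Bennett, E. Bernstein,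
G. Brassard, U. Vazirani, SIAM J. Comput. 26 (1997), Cor. 4.15; J. Watrous, arXiv:0804.3401, §IV.2 Prop. 3;
M. Zhandry, CRYPTO 2012, Thm. 3.1.
-/

-- D-0017: single-conjunct summit ⇒ the duplicate `QuantumAdvantage.QuantumAdvantage` is mandated.
set_option linter.dupNamespace false

noncomputable section

namespace Summit.QuantumAdvantage.QuantumAdvantage.Cruxes.TransferPB.Birth

open Finset Literature.Computability.Cryptography Literature.Computability.Complexity
  Literature.Computability.Complexity.Brick Literature.Computability.Complexity.Plumb
  Literature.Computability.QuantumComplexity Literature.Computability.QuantumComplexity.ClassicalSimulation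
  Literature.Computability.Cryptography.ExplicitKWiseHash
open _root_.Computability CodeFP Polynomial

namespace SimTreePB

variable (F : QCircuitFamily cliffordT)

/-! ### The MEAN slice of the node problem and its keyed run -/

/-- **The MEAN node tests** (`⟨x, ρ, j⟩`, `1 ≤ j ≤ 40`): YES if `E[p_x|_ρ] ≥ j/40`, NO if `E[p_x|_ρ] ≤ (j−1)/40` — the
MEAN instances of `nodeProblem` (whose MEAN clauses do not involve `r, c, k`).
[cite: AaronsonAmbainis2014, Thm. 23 (proof, p. 14)] -/
def meanProblem : PromiseProblem where
  yes := {v | ∃ (x : List Bool) (ρ : List (Fin (numOracleBits F x) × Bool)) (j : ℕ),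
    v = encMean F x ρ j ∧ 1 ≤ j ∧ j ≤ 40 ∧ (j : ℝ) / 40 ≤ nodeMean F x ρ}
  no := {v | ∃ (x : List Bool) (ρ : List (Fin (numOracleBits F x) × Bool)) (j : ℕ),
    v = encMean F x ρ j ∧ 1 ≤ j ∧ j ≤ 40 ∧ nodeMean F x ρ ≤ ((j : ℝ) - 1) / 40}

/-- **The keyed run of the node tests on laid-out instances** (`nOf = nOfLayout`). [cite: Zhandry2012IBE, Thm. 3.1] -/
def meanRun : KeyedRun := keyedRun F nOfLayout nOfLayout_le

/-! ### The answer bit read off the output string -/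

/-- The transported read-out ignores wires appended after the keyed family's own. [folklore] -/
theorem readRun_take (P : KeyedRun) (z y : List Bool) :
    readRun P z (y.take (z.length + P.family.ancillas z.length)) = readRun P z y := by
  unfold readRun
  congr 1
  funext i
  rw [List.getD_eq_getElem?_getD, List.getD_eq_getElem?_getD, List.getElem?_take_of_lt]
  exact (P.emb z.length i).2

/-- `[1] ⊑ l ↔ l[0]? = some 1`. [folklore] -/
theorem true_prefix_iff (l : List Bool) : [true] <+: l ↔ l[0]? = some true := by
  cases l <;> simp

/-- The answer event of a keyed run in terms of one symbol of the output string: there is an answer wire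
(`0 < n + m_F`) and it reads `1` (wire `0` if `0 < n`, else the first ancilla `|z|`).
[cite: BennettBernsteinBrassardVazirani1997, §4 (the subroutine's wires)] -/
theorem true_prefix_readRun_iff (P : KeyedRun) (z s : List Bool) :
    [true] <+: readRun P z s ↔ 0 < P.nOf z.length + P.mF z.length ∧
      s.getD (if 0 < P.nOf z.length then 0 else z.length) false = true := by
  rw [true_prefix_iff, readRun, List.getElem?_ofFn]
  by_cases h : 0 < P.nOf z.length + P.mF z.length
  · rw [dif_pos h]
    simp only [h, true_and, Option.some.injEq, KeyedRun.emb_val]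
    by_cases hn : 0 < P.nOf z.length
    · simp [hn]
    · have hn0 : P.nOf z.length = 0 := by omega
      simp [hn0]
  · rw [dif_neg h]
    simp [h]

/-- **The answer bit of the keyed run, read off the output string `s` on the layout `z`**: there is an answer wire
(`0 < n + anc n`, `n = nOfLayout |z|`) and it reads `1` (the wire is `0` if `0 < n`, else the first ancilla `|z|`).
[cite: BennettBernsteinBrassardVazirani1997, §4 (the subroutine's wires)] -/
def meanStat (z s : List Bool) : Bool :=
  decide (0 < nOfLayout z.length + F.ancillas (nOfLayout z.length)) &&
    s.getD (if decide (0 < nOfLayout z.length) then 0 else z.length) false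

/-- **`meanStat` is the answer event of the keyed run.** [cite: BennettBernsteinBrassardVazirani1997, §4] -/
theorem meanStat_eq (z s : List Bool) : meanStat F z s = decide ([true] <+: readRun (meanRun F) z s) := by
  rw [Bool.eq_iff_iff, decide_eq_true_iff, true_prefix_readRun_iff, meanStat, Bool.and_eq_true, decide_eq_true_iff]
  change _ ↔ 0 < nOfLayout z.length + F.ancillas (nOfLayout z.length) ∧
    s.getD (if 0 < nOfLayout z.length then 0 else z.length) false = true
  by_cases h : 0 < nOfLayout z.length <;> simp [h]

variable {F} in
/-- **`meanStat` is computed on codes**, for a uniform `F`. [cite: AroraBarak2009, §1.3] -/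
theorem meanStatC (hF : F.IsUniform) : CodeFP (pairE strE strE) bitE (fun q => meanStat F q.1 q.2) := by
  have cZ : CodeFP (pairE strE strE) strE (fun q => q.1) := fst _ _
  have cS : CodeFP (pairE strE strE) strE (fun q => q.2) := snd _ _
  have cL : CodeFP (pairE strE strE) unE (fun q => q.1.length) := strLength.comp cZ
  have cN : CodeFP (pairE strE strE) unE (fun q => nOfLayout q.1.length) := codeFP_nOfLayout.comp cL
  have cAnc : CodeFP (pairE strE strE) unE (fun q => (F.rawDesc (nOfLayout q.1.length)).2.1) :=
    (codeFP_rawDesc hF).snd'.fst'.comp cN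
  have cTot := unAdd.comp (cN.pair cAnc)
  have c1 := natLt.comp ((const _ 0).pair (natOfUn.comp cTot))
  have cPosN := natLt.comp ((const _ 0).pair (natOfUn.comp cN))
  have cPos := cPosN.ite (const _ 0) cL
  have c2 := strGetD.comp (cPos.pair cS)
  exact (c1.and c2).congr fun q => rfl

/-! ### The MEAN threshold numeral -/

/-- **The MEAN threshold numerator `2j − 1` read off the layout**: drop the input `x` (`nOfLayout |z|` symbols), take the
instance `v = ⟨x, ⟨encPath ρ, 1 1^j⟩⟩` (first field of the parameter string), its tag-and-target field `1 1^j` has length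
`j + 1`. [cite: AroraBarak2009, §1.3] -/
def meanNum (z : List Bool) : ℕ := 2 * ((sndF (sndF (fstF (z.drop (nOfLayout z.length))))).length - 1) - 1

/-- `meanNum` is computed on codes. [cite: AroraBarak2009, §1.3] -/
theorem meanNumC : CodeFP strE natE meanNum := by
  have cF : CodeFP strE strE fstF := ⟨fstF, fstF_mem_FP, fun _ => rfl⟩
  have cSd : CodeFP strE strE sndF := ⟨sndF, sndF_mem_FP, fun _ => rfl⟩
  have cD : CodeFP strE strE (fun z => z.drop (nOfLayout z.length)) :=
    strDrop.comp ((codeFP_nOfLayout.comp strLength).pair (CodeFP.id strE))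
  have cLen : CodeFP strE natE (fun z => (sndF (sndF (fstF (z.drop (nOfLayout z.length))))).length) :=
    strNatLength.comp (cSd.comp (cSd.comp (cF.comp cD)))
  exact (natSub.comp ((natMul.comp ((const _ 2).pair (natSub.comp (cLen.pair (const _ 1))))).pair (const _ 1))).congr
    fun _ => rfl

/-- **On the layout of a MEAN instance the numeral is `2j − 1`.** [cite: AaronsonAmbainis2014, Thm. 23 (proof, p. 14)] -/
theorem meanNum_layoutFn_encMean (x : List Bool) (ρ : List (Fin (numOracleBits F x) × Bool)) (j : ℕ) :
    meanNum (layoutFn (encMean F x ρ j)) = 2 * j - 1 := by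
  have hv : encMean F x ρ j = boolPair x (boolPair (encPath F x ρ) (true :: List.replicate j true)) := rfl
  rw [meanNum, nOfLayout_encMean, layoutFn_apply, hv, fstF_boolPair, List.drop_left, paramStr, fstF_boolPair,
    sndF_boolPair, sndF_boolPair, List.length_cons, List.length_replicate]
  omega

/-! ### The `PromiseBQP` membership -/

variable {F} in
/-- **The MEAN node tests are in `PromiseBQP`**, for a uniform `F`: the keyed estimator on the laid-out instance has
the answer event with probability exactly `E[p_x|_ρ]`; its oracle `keyedLang F ∈ P ⊆ BQP` is removed at cost `1/160`
on every output event; the one-bit statistic with threshold `(2j−1)/80` and margin `1/160` is amplified and read out.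
[cite: Watrous2009, §IV.2 Prop. 3] [cite: BennettBernsteinBrassardVazirani1997, Cor. 4.15]
[cite: AaronsonAmbainis2014, Thm. 23 (proof, p. 14)] -/
theorem meanProblem_mem_PromiseBQP (hF : F.IsUniform) : meanProblem F ∈ PromiseBQP := by
  classical
  -- the keyed estimator, its oracle, and the oracle-free substitute
  have hA : keyedLang F ∈ BQP := P_subset_BQP_holds (keyedLang_mem_P hF)
  have hU : (meanRun F).family.IsUniform := keyedRun_family_isUniform F hF nOfLayout_le codeFP_nOfLayout
  obtain ⟨G, hGfree, hGU, hclose⟩ := exists_oracleFree_kernelProb_close hA hU (159 : Polynomial ℕ)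
  -- the statistic and the numerals as string functions
  obtain ⟨statU, hstatFP, hstat⟩ := meanStatC hF
  obtain ⟨num, hnumFP, hnum⟩ := meanNumC
  obtain ⟨den, hdenFP, hden⟩ := (CodeFP.const strE (eβ := natE) (80 : ℕ))
  have hstat' : ∀ z s, statU (boolPair z s) = [meanStat F z s] := fun z s => hstat (z, s)
  have hnum' : ∀ z, num z = natE (meanNum z) := fun z => hnum z
  have hden80 : ∀ z, bitsToNat (den z) = 80 := fun z => by
    rw [show den z = natE 80 from hden z]; exact bitsToNat_natE 80
  have h160 : ∀ z : List Bool, (1 : ℝ) / ((((159 : Polynomial ℕ).eval z.length : ℕ) : ℝ) + 1) = 1 / 160 := by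
    intro z; norm_num
  -- the mean of the statistic is the oracle-free probability of the answer event
  have hmean : ∀ z, PolyCopies.bsMean G statU (fun _ => 1) z =
      G.kernelProb 0 z {s | [true] <+: readRun (meanRun F) z s} := by
    intro z
    rw [PolyCopies.bsMean, Finset.sum_range_one]
    congr 1
    ext s
    simp only [Set.mem_setOf_eq, hstat', List.getD_cons_zero, meanStat_eq, decide_eq_true_iff]
  -- oracle removal on the answer event
  have happrox : ∀ z, |G.kernelProb 0 z {s | [true] <+: readRun (meanRun F) z s} -
      (meanRun F).family.kernelProb (keyedLang F) z {s | [true] <+: readRun (meanRun F) z s}| ≤ 1 / 160 := by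
    intro z
    have h := hclose z {s | [true] <+: readRun (meanRun F) z s}
    rw [h160] at h
    have hset : {y' : List Bool | y'.take (z.length + (meanRun F).family.ancillas z.length) ∈
        {s : List Bool | [true] <+: readRun (meanRun F) z s}} = {s | [true] <+: readRun (meanRun F) z s} := by
      ext y'
      simp only [Set.mem_setOf_eq, readRun_take]
    rwa [hset] at h
  refine mem_PromiseBQP_of_blockStat_thresholds_pre (meanProblem F) layoutFn_mem_FP hGfree hGU hstatFP
    hnumFP hdenFP (fun _ => 1) (fun z s _ => ?_) 159 (fun v _ => ?_) (fun v _ => ?_) (fun v hv => ?_) (fun v hv => ?_)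
  · rw [hstat']; simp
  · rw [hden80]; norm_num
  · rw [hden80]; norm_num
  · obtain ⟨x, ρ, j, rfl, hj1, hj40, hyes⟩ := hv
    rw [hmean, h160, hden80, hnum', bitsToNat_natE, meanNum_layoutFn_encMean]
    have hex : (meanRun F).family.kernelProb (keyedLang F) (layoutFn (encMean F x ρ j))
        {s | [true] <+: readRun (meanRun F) (layoutFn (encMean F x ρ j)) s} = nodeMean F x ρ :=
      kernelProb_keyedRun_layoutFn_encMean F x ρ j
    have ha := happrox (layoutFn (encMean F x ρ j))
    rw [hex, abs_le] at ha
    have hcast : ((2 * j - 1 : ℕ) : ℝ) = 2 * (j : ℝ) - 1 := by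
      rw [Nat.cast_sub (by omega), Nat.cast_mul]; norm_num
    rw [hcast]
    linarith [ha.1]
  · obtain ⟨x, ρ, j, rfl, hj1, hj40, hno⟩ := hv
    rw [hmean, h160, hden80, hnum', bitsToNat_natE, meanNum_layoutFn_encMean]
    have hex : (meanRun F).family.kernelProb (keyedLang F) (layoutFn (encMean F x ρ j))
        {s | [true] <+: readRun (meanRun F) (layoutFn (encMean F x ρ j)) s} = nodeMean F x ρ :=
      kernelProb_keyedRun_layoutFn_encMean F x ρ j
    have ha := happrox (layoutFn (encMean F x ρ j))
    rw [hex, abs_le] at ha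
    have hcast : ((2 * j - 1 : ℕ) : ℝ) = 2 * (j : ℝ) - 1 := by
      rw [Nat.cast_sub (by omega), Nat.cast_mul]; norm_num
    rw [hcast]
    linarith [ha.2]

end SimTreePB

end Summit.QuantumAdvantage.QuantumAdvantage.Cruxes.TransferPB.Birth

end
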